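import Literature.AlgebraicGeometry.Frobenioids.BiratPaths
import HarnessLib

/-!
# Frobenioids I, Theorem 5.2 (iv), proof step: the `F_Φ`-data of the comparison functor along
`F_P`-paths

Mochizuki, *The geometry of Frobenioids I: the general theory*, Kyushu J. Math. **62** (2008)
293–400, §5, proof of Theorem 5.2 (iv), kurims text p. 102 [cite: MochizukiFrdI2008, Thm. 5.2(iv)
p.102]:
"we may associate to any morphism `φ : C → C'` a morphism
`(deg_Fr(φ), Base(ζ_{A'}) ∘ Base(ζ_{C'})⁻¹ ∘ Base(φ) ∘ Base(ζ_C) ∘ Base(ζ_A)⁻¹ : A → A',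
(Φ(ζ_A)⁻¹ ∘ Φ(ζ_C))(Div(φ)) ∈ Φ(A), {…}_{O^×} ∈ O^×(A^birat))` … it is a routine exercise to verify
that these assignments determine a functor … Indeed, this is immediate for the first three entries".

This file does the "first three entries": for objects `X, X'` of `C` equipped with `F_P`-paths
(`BiratPaths.lean`) and `φ : X → X'` it defines the base entry `baseOf`, the divisor entry `divOf`
and packages `(baseOf, divOf, deg_Fr φ)` as a morphism `elemHom φ : A_D → A'_D` of the elementary
Frobenioid `F_Φ`, proving functoriality (`elemHom_id`, `elemHom_comp`) — Remark 1.1.1 bookkeeping.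
The fourth (unit) entry needs the Remark 2.7.2 factorisation in `E ⊆ C^birat` and is not treated
here.
-/

namespace Literature.AlgebraicGeometry.Frobenioids

open CategoryTheory Opposite

universe w v v' u u'

namespace PreFrobenioid

namespace FPPath

variable {D : Type u} [Category.{v} D] {Φ : Dᵒᵖ ⥤ CommMonCat.{w}}
  {C : Type u'} [Category.{v'} C] {F : C ⥤ ElemFrobenioid Φ} {P : Set C} {X X' X'' : C}

/-- The base entry `Base(ζ_{A'}) ∘ Base(ζ_{X'})⁻¹ ∘ Base(φ) ∘ Base(ζ_X) ∘ Base(ζ_A)⁻¹ : A_D → A'_D`.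
[cite: MochizukiFrdI2008, Thm. 5.2(iv) p.102] -/
noncomputable def baseOf (p : FPPath F P X) (p' : FPPath F P X') (φ : X ⟶ X') :
    baseObj F p.A ⟶ baseObj F p'.A :=
  haveI : IsIso (Base F p.ζA) := p.ζA_mem.2.2
  haveI : IsIso (Base F p'.ζX) := p'.ζX_mem.2.2
  inv (Base F p.ζA) ≫ Base F p.ζX ≫ Base F φ ≫ inv (Base F p'.ζX) ≫ Base F p'.ζA

/-- The divisor entry `(Φ(ζ_A)⁻¹ ∘ Φ(ζ_X))(Div φ) ∈ Φ(A_D)`. [cite: MochizukiFrdI2008, Thm. 5.2(iv)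
p.102] -/
noncomputable def divOf (p : FPPath F P X) (φ : X ⟶ X') : Φ.obj (op (baseObj F p.A)) :=
  haveI : IsIso (Base F p.ζA) := p.ζA_mem.2.2
  pull Φ (inv (Base F p.ζA)) (pull Φ (Base F p.ζX) (Div F φ))

/-- `baseOf (𝟙 X) = 𝟙` (same path). [cite: MochizukiFrdI2008, Thm. 5.2(iv) p.102] -/
theorem baseOf_id (p : FPPath F P X) : baseOf p p (𝟙 X) = 𝟙 _ := by
  haveI : IsIso (Base F p.ζA) := p.ζA_mem.2.2
  haveI : IsIso (Base F p.ζX) := p.ζX_mem.2.2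
  unfold baseOf
  rw [base_id, Category.id_comp, IsIso.hom_inv_id_assoc, IsIso.inv_hom_id]

/-- `baseOf (φ ≫ φ') = baseOf φ ≫ baseOf φ'`. [cite: MochizukiFrdI2008, Thm. 5.2(iv) p.102] -/
theorem baseOf_comp (p : FPPath F P X) (p' : FPPath F P X') (p'' : FPPath F P X'') (φ : X ⟶ X')
    (φ' : X' ⟶ X'') : baseOf p p'' (φ ≫ φ') = baseOf p p' φ ≫ baseOf p' p'' φ' := by
  haveI : IsIso (Base F p.ζA) := p.ζA_mem.2.2
  haveI : IsIso (Base F p'.ζA) := p'.ζA_mem.2.2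
  haveI : IsIso (Base F p'.ζX) := p'.ζX_mem.2.2
  haveI : IsIso (Base F p''.ζX) := p''.ζX_mem.2.2
  unfold baseOf
  simp only [base_comp, Category.assoc, IsIso.hom_inv_id_assoc, IsIso.inv_hom_id_assoc]

/-- `baseOf` is the base map of the conjugated birational morphism `pathHom φ`.
[cite: MochizukiFrdI2008, Thm. 5.2(iv) p.102] -/
theorem base_pathHom_eq_baseOf {hF : IsFrobenioid F} {hsq : HasBiratSquares F} (p : FPPath F P X)
    (p' : FPPath F P X') (φ : X ⟶ X') :
    Base (Birat.toElemGp hF hsq) (pathHom hF hsq p p' φ) = baseOf p p' φ :=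
  base_pathHom p p' φ

/-- `divOf (𝟙 X) = 0`. [cite: MochizukiFrdI2008, Thm. 5.2(iv) p.102] -/
theorem divOf_id (p : FPPath F P X) : divOf p (𝟙 X) = 1 := by
  unfold divOf
  rw [div_id, map_one, map_one]

/-- Remark 1.1.1 for the divisor entry: `divOf (φ ≫ φ') = baseOf(φ)^* divOf(φ') + deg_Fr(φ') ·
divOf(φ)`.
[cite: MochizukiFrdI2008, Rem. 1.1.1] -/
theorem divOf_comp (p : FPPath F P X) (p' : FPPath F P X') (φ : X ⟶ X') (φ' : X' ⟶ X'') :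
    divOf p (φ ≫ φ') = pull Φ (baseOf p p' φ) (divOf p' φ') * divOf p φ ^ (degFr F φ' : ℕ) := by
  haveI : IsIso (Base F p.ζA) := p.ζA_mem.2.2
  haveI : IsIso (Base F p'.ζA) := p'.ζA_mem.2.2
  haveI : IsIso (Base F p'.ζX) := p'.ζX_mem.2.2
  unfold divOf baseOf
  rw [div_comp, map_mul, map_pow, map_mul, map_pow, ← pull_comp, ← pull_comp, ← pull_comp,
    ← pull_comp, ← pull_comp]
  simp only [Category.assoc, IsIso.hom_inv_id_assoc, IsIso.inv_hom_id, Category.comp_id]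

/-- The `F_Φ`-part of the comparison functor on morphisms: `(baseOf φ, divOf φ, deg_Fr φ)` as a
morphism
`A_D → A'_D` of `F_Φ`. [cite: MochizukiFrdI2008, Thm. 5.2(iv) p.102] -/
noncomputable def elemHom (p : FPPath F P X) (p' : FPPath F P X') (φ : X ⟶ X') :
    ElemFrobenioid.of Φ (baseObj F p.A) ⟶ ElemFrobenioid.of Φ (baseObj F p'.A) :=
  ElemFrobenioid.homMk (A := ElemFrobenioid.of Φ (baseObj F p.A))
    (B := ElemFrobenioid.of Φ (baseObj F p'.A)) (baseOf p p' φ) (divOf p φ) (degFr F φ)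

/-- Functoriality of the `F_Φ`-part: identities. [cite: MochizukiFrdI2008, Thm. 5.2(iv) p.102] -/
theorem elemHom_id (p : FPPath F P X) : elemHom p p (𝟙 X) = 𝟙 _ := by
  apply ElemFrobenioid.Hom.ext
  · exact baseOf_id p
  · exact divOf_id p
  · exact degFr_id F X

/-- Functoriality of the `F_Φ`-part: composition ("immediate for the first three entries").
[cite: MochizukiFrdI2008, Thm. 5.2(iv) p.102] -/
theorem elemHom_comp (p : FPPath F P X) (p' : FPPath F P X') (p'' : FPPath F P X'') (φ : X ⟶ X')
    (φ' : X' ⟶ X'') : elemHom p p'' (φ ≫ φ') = elemHom p p' φ ≫ elemHom p' p'' φ' := by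
  apply ElemFrobenioid.Hom.ext
  · exact baseOf_comp p p' p'' φ φ'
  · exact divOf_comp p p' φ φ'
  · exact degFr_comp F φ φ'

end FPPath

end PreFrobenioid

end Literature.AlgebraicGeometry.Frobenioids
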